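import Literature.MathematicalPhysics.QuantumFieldTheory.Balaban1983to89.B3Op116MajorantConvolution

/-!
# `Balaban1983to89.B3Op116SliceSums` — T. Bałaban, *(Higgs)₂,₃ quantum fields in a finite volume. III. Renormalization*,
# Commun. Math. Phys. **88** (1983) 411–445 [Balaban1983Higgs3], (1.16) p. 414 / (2.6), (2.10) pp. 424–426 / p. 433:
# **LATTICE SUMS OVER A HYPERPLANE SLICE (a face of a cell-product box) IN THE (2.6)/(2.10) CURRENCY** — the torus sum of
# [Balaban1983RegularityDecay] Sect. 5 with ONE COORDINATE FROZEN, and two (2.10)-bumps on two scales summed over a face: the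
# `(d−1)`-dimensional volume of the finer scale, the decay of the finer bump in the height of its anchor, half the decay of the coarser

statement-level skeleton of published theorems with citation tags; proofs where landed; nothing here is a claim about the Yang–Mills mass gap

PDF held: `paper:balaban1983-higgs-2-3-quantum-fields-finite-volume` p. 414 [PDF 4] ((1.16) and its sentence), p. 424 [14] (2.5)/(2.6), p. 426 [16]
(2.10), p. 433 [23] (the cube `□` and the expansion in `B̃′`); `paper:balaban1983-cmp89-regularity-decay` Sect. 5 p. 594 (lattice sums).

CITATION HEADER (lean-in-tree rule).  T. Bałaban, CMP **88** (1983) 411–445 [Balaban1983Higgs3]: (1.16) p. 414, (2.5)/(2.6) p. 424, (2.10) p. 426,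
p. 433; T. Bałaban, CMP **89** (1983) 571–597 [Balaban1983RegularityDecay], Sect. 5 Theorem p. 594; T. Bałaban, CMP **85** (1982) 603–626
[Balaban1982Higgs1], (1.3) p. 604 (the torus distance).  Cell `lit-balaban` (HOME `run/shared/lean/pub/lit-balaban/`), Phase-2 proof seat **p35** gen 26
(literature-prover-lit-balaban-p35-g26-0; free-target protocol G.5-34(d), TAKING HOME/STATUS.md 2026-08-23T12:38:30Z, cc p40 / p33 / r14 / r15).
SKELETON rows **B3.Eq1.16** / **B3.Eq2.5** / **B3.Txt@433** (owner r15) — LOCATED ENGINE FILE, no head claim: the first brick of the «(2.5) for (1.16) on a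
cell-product box without the support clause» programme (GAPS.md G-B3-16 ADDENDUM 1, owner countersign 2026-08-23T12:25:18Z; p35 `DESIGN-FILE4.md` §14;
p40 `DESIGN-B3-116-box.md` §2a/§5.1 FILE 1 (b)), where the Leibniz rows of `V_k(Ã,B̃)` restricted to the bonds of a box `□` leave SINGLE LAYERS
(«face sheets») on the boundary hyperplanes of `□`.  Sibling of p33's `B3Op116MajorantConvolution` (imported; its `conv2_scales_le` / `pair_scale_algebra`
are twinned here with the volume exponent `d − 1`), of FILE E `B3Op116ScaleChains` (`exp_mul_exp_le_split`, `rate_eq`) and of `B4Sect5Torus.torusSum_le`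
(whose coordinate factorisation is repeated with the `ν`-th factor frozen).

WHAT IS PRINTED (verbatim).  p. 414 [PDF 4]: *"More exactly the Hölder norms of the covariant derivatives of this kernel … are exponentially decaying
with the distance of the arguments and are uniformly bounded by O(1)(e(L^kε)^{1−α})^{n+n′} … This estimate follows easily from the properties of the
propagators G_k(Ω, A) proved in the next paper."*  p. 433 [PDF 23]: *"we take a cube □ of size 3r(L^kε) … We have B̃ = B̃₀ + B̃′, and we expand in B̃′
… using the formulas (I.3.14), (I.3.44), and (I.3.45) … we include the operators (1.16) … into the external fields"*.  (2.10) p. 426: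
*"|G^η_{(j)}(Ω,B̃;x,x′)| ≤ O(1)(L^jη)^{−d+2}e^{−δ₁(L^jη)^{−1}|x−x′|}"*.  [Balaban1983RegularityDecay] p. 594: the uniform lattice sums of Sect. 5.

WHAT THIS FILE PROVES (pure lattice-sum lemmas; every torus `HiggsLattice.Site P k` of the model, uniform in the volume).
* §1 `two_mul_inv_one_sub_exp_le` (`2(1−e^{−u})⁻¹ ≤ 4/u`, `0 < u ≤ 1/2`); **`tsliceSum_le`** (engine torus `Π_i ℤ/P_iℤ`):
  `Σ_{y : y_ν = c} e^{−a·tdist(x,y)} ≤ e^{−(a/d)·dist(x_ν − c, P_νℤ)}·(2(1−e^{−a/d})⁻¹)^{d−1}`; **`sliceSum_exp_le`** (the same on `T^{(k)}`, height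
  `h = min{(x_ν−c) mod, (c−x_ν) mod}`, transported along `B1Ineq234Concrete.toT`); `sliceConst_scale_le`, **`sliceSum_scale_le`** (at the rate `δ/(2L^j)`:
  `≤ (8d/δ)^{d−1}(L^j)^{d−1}·e^{−(δ/(2dL^j))h}` — the `(d−1)`-volume of the scale and the decay in the height).
* §2 `sum_face_le_sum_ite`; **`face_conv2_le`** (`j₁ ≤ j₂`, `F ⊆ {s_ν = c}`): `Σ_{s∈F} e_{j₁}(x,s)e_{j₂}(s,y) ≤ (8d/δ)^{d−1}(L^{j₁})^{d−1}·
  e^{−(δ/2d)(L^{j₁}ε)^{−1}ε h_x}·e^{−(δ/2)(L^{j₂}ε)^{−1}ε|x−y|}`; `face_conv2_le'` (the second bump the finer: height of `y`); **`face_conv2_scales_le`**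
  (either order, no height factor: volume `(L^{min})^{d−1}`, decay of `L^{max}` halved); **`face_pair_scale_algebra`**:
  `(L^{j₁}ε)^{a₁−d}(L^{j₂}ε)^{a₂−d}(L^{min})^{d−1} = (L^{j₁}ε)^{a₁}(L^{j₂}ε)^{a₂}((L^{max}ε)^d)^{−1}(L^{min}ε)^{−1}(ε^{d−1})^{−1}` (one inverse power of the
  finer scale = the codimension of the face; `ε^{−(d−1)}` = the surface normalisation).
HONEST SCOPE.  No propagator, field, box or (1.16) object appears here; which single layers occur and how they are consumed is the business of the
sequel files (`B3Op116FaceSums`: the face convolution of two majorants and the composed «pending-sheet» step; `B3Op116FaceSumsBorderline`: the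
exponent-one borderline with its explicit height sum) and of the box programme F2–F6 of `DESIGN-FILE4.md` §14 (not in the tree).  Constants not optimized.
Theorems only: no `def`, no `def … : Prop`, no `sorry`; axioms standard.
-/

noncomputable section

open scoped BigOperators

namespace Literature.MathematicalPhysics.QuantumFieldTheory.Balaban1983to89.B3Op116SliceSums

open B1Eq230FluctCov (Ix)
open B1Ineq234Concrete (toT toT_injective periods one_le_periods sdist_eq_tdist)
open B4TorusKernel.MultiPeriod (circAbs)
open B4Sect5Torus (TSite torusSum1_le circAbs_le_tdist)
open B3Op116ScaleChains (rate_eq exp_mul_exp_le_split)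

variable {P : HiggsLattice.Params} {N : ℕ}

/-! ## §1 Slice sums: the torus sum of [B4] Sect. 5 with one coordinate frozen -/

section Slice

/-- **The one-dimensional constant at small rate**: `2(1 − e^{−u})⁻¹ ≤ 4/u` for `0 < u ≤ 1/2` (from `|e^x − 1 − x| ≤ x²`, `|x| ≤ 1`).
[cite: Balaban1983RegularityDecay, Sect. 5 Theorem p.594] -/
theorem two_mul_inv_one_sub_exp_le {u : ℝ} (hu : 0 < u) (hu2 : u ≤ 1 / 2) :
    2 * (1 - Real.exp (-u))⁻¹ ≤ 4 / u := by
  have hlow : u / 2 ≤ 1 - Real.exp (-u) := by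
    have h := Real.abs_exp_sub_one_sub_id_le (x := -u) (by rw [abs_neg, abs_of_nonneg hu.le]; linarith)
    have h1 : Real.exp (-u) - 1 - (-u) ≤ (-u) ^ 2 := le_of_abs_le h
    have h2 : u ^ 2 ≤ u / 2 := by nlinarith
    nlinarith
  have hpos : 0 < u / 2 := by positivity
  have hinv : (1 - Real.exp (-u))⁻¹ ≤ (u / 2)⁻¹ := inv_anti₀ hpos hlow
  calc 2 * (1 - Real.exp (-u))⁻¹ ≤ 2 * (u / 2)⁻¹ := mul_le_mul_of_nonneg_left hinv (by norm_num)
    _ = 4 / u := by field_simp; ring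

/-- `2(1 − e^{−u})⁻¹ ≥ 0` for `u ≥ 0`. [cite: Balaban1983RegularityDecay, Sect. 5 Theorem p.594] -/
theorem two_mul_inv_one_sub_exp_nonneg {u : ℝ} (hu : 0 ≤ u) : 0 ≤ 2 * (1 - Real.exp (-u))⁻¹ := by
  have : Real.exp (-u) ≤ 1 := Real.exp_le_one_iff.mpr (by linarith)
  exact mul_nonneg (by norm_num) (inv_nonneg.mpr (by linarith))

/-- **Slice sums on the engine's torus, uniformly in the periods**: for the discrete torus `Π_i ℤ/P_iℤ` (all `P_i ≥ 1`), a direction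
`ν`, a level `c ∈ ℤ/P_νℤ`, a centre `x` and a rate `a > 0`,
`Σ_{y : y_ν = c} e^{−a·tdist(x,y)} ≤ e^{−(a/d)·dist(x_ν − c, P_νℤ)}·(2(1 − e^{−a/d})⁻¹)^{d−1}` — the factorisation of
`B4Sect5Torus.torusSum_le` (`e^{−a·sup} ≤ Π_i e^{−(a/d)·dist_i}`) with the `ν`-th factor frozen at the height of `x` above the slice.
[cite: Balaban1983RegularityDecay, Sect. 5 Theorem p.594] -/
theorem tsliceSum_le (d : ℕ) {Pv : Fin d → ℕ} (hP : ∀ i, 1 ≤ Pv i) {a : ℝ} (ha : 0 < a) (x : TSite d Pv)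
    (ν : Fin d) (c : Fin (Pv ν)) :
    ∑ y : TSite d Pv, (if y ν = c then Real.exp (-(a * B4Sect5Torus.tdist Pv x y)) else 0)
      ≤ Real.exp (-(a / d * (circAbs (Pv ν) (((x ν).val : ℤ) - ((c.val : ℕ) : ℤ)) : ℝ))) *
          (2 * (1 - Real.exp (-(a / d)))⁻¹) ^ (d - 1) := by
  classical
  have hd : 0 < (d : ℝ) := by exact_mod_cast Fin.pos ν
  -- the factorised comparison functions
  set g : (i : Fin d) → Fin (Pv i) → ℝ := fun i t =>
    if i = ν then (if (t.val : ℤ) = ((c.val : ℕ) : ℤ) then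
        Real.exp (-(a / d * (circAbs (Pv i) (((x i).val : ℤ) - (t.val : ℤ)) : ℝ))) else 0)
    else Real.exp (-(a / d * (circAbs (Pv i) (((x i).val : ℤ) - (t.val : ℤ)) : ℝ))) with hg
  have hg0 : ∀ i t, 0 ≤ g i t := by
    intro i t; simp only [hg]; split_ifs <;> first | exact (Real.exp_pos _).le | exact le_rfl
  -- termwise comparison
  have hcoord : ∀ y : TSite d Pv,
      (if y ν = c then Real.exp (-(a * B4Sect5Torus.tdist Pv x y)) else 0) ≤ ∏ i, g i (y i) := by
    intro y
    split_ifs with hy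
    · -- `e^{−a·tdist} ≤ Π_i e^{−(a/d) dist_i}` and the `ν`-th factor of `g` is the plain exponential at `y ν = c`
      have h1 : Real.exp (-(a * B4Sect5Torus.tdist Pv x y))
          ≤ ∏ i, Real.exp (-(a / d * (circAbs (Pv i) (((x i).val : ℤ) - ((y i).val : ℤ)) : ℝ))) := by
        rw [← Real.exp_sum]
        apply Real.exp_le_exp.mpr
        have hsum : ∑ i : Fin d, a / d * (circAbs (Pv i) (((x i).val : ℤ) - ((y i).val : ℤ)) : ℝ)
            ≤ a * B4Sect5Torus.tdist Pv x y := by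
          calc ∑ i : Fin d, a / d * (circAbs (Pv i) (((x i).val : ℤ) - ((y i).val : ℤ)) : ℝ)
              ≤ ∑ _i : Fin d, a / d * B4Sect5Torus.tdist Pv x y :=
                Finset.sum_le_sum fun i _ =>
                  mul_le_mul_of_nonneg_left (circAbs_le_tdist hP x y i) (div_nonneg ha.le hd.le)
            _ = (d : ℝ) * (a / d * B4Sect5Torus.tdist Pv x y) := by
                rw [Finset.sum_const, Finset.card_univ, Fintype.card_fin, nsmul_eq_mul]
            _ = a * B4Sect5Torus.tdist Pv x y := by field_simp
        rw [Finset.sum_neg_distrib]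
        linarith
      refine h1.trans (le_of_eq ?_)
      refine Finset.prod_congr rfl fun i _ => ?_
      simp only [hg]
      by_cases hi : i = ν
      · subst hi
        have : ((y i).val : ℤ) = ((c.val : ℕ) : ℤ) := by rw [hy]
        rw [if_pos rfl, if_pos this]
      · rw [if_neg hi]
    · exact Finset.prod_nonneg fun i _ => hg0 i (y i)
  -- the one-dimensional sums
  have h1d : ∀ i : Fin d, i ≠ ν → ∑ t : Fin (Pv i), g i t ≤ 2 * (1 - Real.exp (-(a / d)))⁻¹ := by
    intro i hi
    simp only [hg, if_neg hi]
    exact torusSum1_le (hP i) ((x i).val : ℤ) (div_pos ha hd)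
  have hνd : ∑ t : Fin (Pv ν), g ν t
      = Real.exp (-(a / d * (circAbs (Pv ν) (((x ν).val : ℤ) - ((c.val : ℕ) : ℤ)) : ℝ))) := by
    simp only [hg, if_pos rfl]
    rw [Finset.sum_eq_single c]
    · simp
    · intro t _ htc
      have : ¬ ((t.val : ℤ) = ((c.val : ℕ) : ℤ)) := fun h => htc (Fin.ext (by exact_mod_cast h))
      rw [if_neg this]
    · intro h; exact absurd (Finset.mem_univ c) h
  -- assemble
  calc ∑ y : TSite d Pv, (if y ν = c then Real.exp (-(a * B4Sect5Torus.tdist Pv x y)) else 0)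
      ≤ ∑ y : TSite d Pv, ∏ i, g i (y i) := Finset.sum_le_sum fun y _ => hcoord y
    _ = ∏ i : Fin d, ∑ t : Fin (Pv i), g i t := (Fintype.prod_sum g).symm
    _ = (∑ t : Fin (Pv ν), g ν t) * ∏ i ∈ Finset.univ.erase ν, ∑ t : Fin (Pv i), g i t :=
        (Finset.mul_prod_erase Finset.univ (fun i => ∑ t : Fin (Pv i), g i t) (Finset.mem_univ ν)).symm
    _ ≤ Real.exp (-(a / d * (circAbs (Pv ν) (((x ν).val : ℤ) - ((c.val : ℕ) : ℤ)) : ℝ))) *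
          ∏ _i ∈ Finset.univ.erase ν, (2 * (1 - Real.exp (-(a / d)))⁻¹) := by
        rw [hνd]
        refine mul_le_mul_of_nonneg_left ?_ (Real.exp_pos _).le
        apply Finset.prod_le_prod
        · intro i _; exact Finset.sum_nonneg fun t _ => hg0 i t
        · intro i hi
          exact h1d i (Finset.ne_of_mem_erase hi)
    _ = _ := by
        rw [Finset.prod_const, Finset.card_erase_of_mem (Finset.mem_univ ν), Finset.card_univ, Fintype.card_fin]


/-- **Slice sums on the tori `T^{(k)}` of the model** (1.2)/(1.3): for a direction `ν`, a level `c ∈ ℤ/(2L^{K−k}ML′_ν)ℤ`, a centre `x` and a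
rate `a > 0`, `Σ_{y : y_ν = c} e^{−a|x − y|} ≤ e^{−(a/d)·h}·(2(1 − e^{−a/d})⁻¹)^{d−1}` with the HEIGHT `h = min{(x_ν − c) mod, (c − x_ν) mod}` of `x`
above the slice (lattice units) — transported from `tsliceSum_le` along `B1Ineq234Concrete.toT` (the slice of `T^{(k)}` embeds into the slice of the
engine's torus; `|x − y|` = the engine's distance, `sdist_eq_tdist`). [cite: Balaban1982Higgs1, (1.3) p.604] [cite: Balaban1983RegularityDecay, Sect. 5 Theorem p.594] -/
theorem sliceSum_exp_le {k : ℕ} {a : ℝ} (ha : 0 < a) (x : HiggsLattice.Site P k) (ν : Fin P.d)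
    (c : ZMod (P.sitesPerDir k ν)) :
    ∑ y : HiggsLattice.Site P k, (if y ν = c then Real.exp (-(a * (HiggsLattice.Site.tdist x y : ℝ))) else 0)
      ≤ Real.exp (-(a / P.d * ((min (x ν - c).val (c - x ν).val : ℕ) : ℝ))) *
          (2 * (1 - Real.exp (-(a / P.d)))⁻¹) ^ (P.d - 1) := by
  classical
  set cT : Fin (periods P k ν) := ⟨c.val, ZMod.val_lt c⟩ with hcT
  set G : TSite P.d (periods P k) → ℝ := fun z =>
    if z ν = cT then Real.exp (-(a * B4Sect5Torus.tdist (periods P k) (toT x) z)) else 0 with hG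
  have hG0 : ∀ z, 0 ≤ G z := fun z => by simp only [hG]; split_ifs <;> first | exact (Real.exp_pos _).le | exact le_rfl
  -- the summand of `T^{(k)}` is the engine summand at `toT y`
  have hterm : ∀ y : HiggsLattice.Site P k,
      (if y ν = c then Real.exp (-(a * (HiggsLattice.Site.tdist x y : ℝ))) else 0) = G (toT y) := by
    intro y
    have hiff : y ν = c ↔ toT y ν = cT := by
      constructor
      · intro h; apply Fin.ext; simp [toT, hcT, h]
      · intro h
        have h' := congrArg Fin.val h
        simp only [toT, hcT] at h'
        exact ZMod.val_injective _ h'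
    have hdist : B4Sect5Torus.tdist (periods P k) (toT x) (toT y) = (HiggsLattice.Site.tdist x y : ℝ) :=
      sdist_eq_tdist x y
    simp only [hG]
    by_cases hy : y ν = c
    · rw [if_pos hy, if_pos (hiff.mp hy), hdist]
    · rw [if_neg hy, if_neg (fun h => hy (hiff.mpr h))]
  -- the height in the two languages
  have hheight : (circAbs (periods P k ν) ((((toT x) ν).val : ℤ) - ((cT.val : ℕ) : ℤ)) : ℝ)
      = ((min (x ν - c).val (c - x ν).val : ℕ) : ℝ) := by
    have h1 := B1Ineq234Concrete.circAbs_val_sub (x ν) c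
    have h2 : (((circAbs (P.sitesPerDir k ν) (((x ν).val : ℤ) - ((c.val : ℕ) : ℤ))).toNat : ℕ) : ℤ)
        = circAbs (P.sitesPerDir k ν) (((x ν).val : ℤ) - ((c.val : ℕ) : ℤ)) :=
      Int.toNat_of_nonneg (B4TorusKernel.MultiPeriod.circAbs_nonneg (P.sitesPerDir_pos k ν) _)
    have h3 : (circAbs (P.sitesPerDir k ν) (((x ν).val : ℤ) - ((c.val : ℕ) : ℤ)) : ℝ)
        = (((circAbs (P.sitesPerDir k ν) (((x ν).val : ℤ) - ((c.val : ℕ) : ℤ))).toNat : ℕ) : ℝ) := by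
      exact_mod_cast h2.symm
    simp only [toT, hcT, periods]
    rw [h3, h1]
  calc ∑ y : HiggsLattice.Site P k, (if y ν = c then Real.exp (-(a * (HiggsLattice.Site.tdist x y : ℝ))) else 0)
      = ∑ y : HiggsLattice.Site P k, G (toT y) := Finset.sum_congr rfl fun y _ => hterm y
    _ = ∑ z ∈ Finset.univ.image (toT (P := P) (k := k)), G z := by
        rw [Finset.sum_image (fun _ _ _ _ h => toT_injective h)]
    _ ≤ ∑ z : TSite P.d (periods P k), G z :=
        Finset.sum_le_sum_of_subset_of_nonneg (Finset.subset_univ _) (fun z _ _ => hG0 z)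
    _ ≤ Real.exp (-(a / P.d * (circAbs (periods P k ν) ((((toT x) ν).val : ℤ) - ((cT.val : ℕ) : ℤ)) : ℝ))) *
          (2 * (1 - Real.exp (-(a / P.d)))⁻¹) ^ (P.d - 1) :=
        tsliceSum_le P.d (one_le_periods P k) ha (toT x) ν cT
    _ = _ := by rw [hheight]


/-- **The slice constant at the (2.10) rate of scale `j`**: `(2(1 − e^{−δ/(2dL^j)})⁻¹)^{d−1} ≤ (8d/δ)^{d−1}·(L^j)^{d−1}` for `0 < δ ≤ 1` — the
`(d−1)`-dimensional volume of the `j`-th scale in lattice units. [cite: Balaban1983Higgs3, (2.10) p.426] [cite: Balaban1983RegularityDecay, Sect. 5 Theorem p.594] -/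
theorem sliceConst_scale_le {δ : ℝ} (hδ : 0 < δ) (hδ1 : δ ≤ 1) (j : ℕ) :
    (2 * (1 - Real.exp (-(δ / (P.L : ℝ) ^ j / 2 / P.d)))⁻¹) ^ (P.d - 1)
      ≤ (8 * P.d / δ) ^ (P.d - 1) * ((P.L : ℝ) ^ j) ^ (P.d - 1) := by
  have hd1 : (1 : ℝ) ≤ P.d := by exact_mod_cast P.hd
  have hd0 : (0 : ℝ) < P.d := by linarith
  have hL : (1 : ℝ) ≤ (P.L : ℝ) ^ j := one_le_pow₀ (by exact_mod_cast P.hL)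
  have hLpos : (0 : ℝ) < (P.L : ℝ) ^ j := by positivity
  set u : ℝ := δ / (P.L : ℝ) ^ j / 2 / P.d with hu
  have hu0 : 0 < u := by positivity
  have hu2 : u ≤ 1 / 2 := by
    rw [hu, div_le_iff₀ hd0, div_le_iff₀ (by norm_num : (0:ℝ) < 2)]
    have : δ / (P.L : ℝ) ^ j ≤ 1 := (div_le_self hδ.le hL).trans hδ1
    nlinarith
  have h1 := two_mul_inv_one_sub_exp_le hu0 hu2
  have h2 : 4 / u = 8 * P.d / δ * (P.L : ℝ) ^ j := by
    rw [hu]; field_simp; ring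
  rw [← mul_pow, ← h2]
  exact pow_le_pow_left₀ (two_mul_inv_one_sub_exp_nonneg hu0.le) h1 _

/-- **Slice sums at the rate of scale `j`** (`0 < δ ≤ 1`): `Σ_{y : y_ν = c} e^{−(δ/2L^j)|x−y|} ≤ (8d/δ)^{d−1}(L^j)^{d−1}·e^{−(δ/(2dL^j))·h}`,
`h` = the height of `x` above the slice `{y_ν = c}` — the `(d−1)`-dimensional volume of the scale and the decay in the height.
[cite: Balaban1983Higgs3, (2.10) p.426] [cite: Balaban1983RegularityDecay, Sect. 5 Theorem p.594] -/
theorem sliceSum_scale_le {k : ℕ} {δ : ℝ} (hδ : 0 < δ) (hδ1 : δ ≤ 1) (j : ℕ) (x : HiggsLattice.Site P k) (ν : Fin P.d)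
    (c : ZMod (P.sitesPerDir k ν)) :
    ∑ y : HiggsLattice.Site P k,
        (if y ν = c then Real.exp (-(δ / (P.L : ℝ) ^ j / 2 * (HiggsLattice.Site.tdist x y : ℝ))) else 0)
      ≤ (8 * P.d / δ) ^ (P.d - 1) * ((P.L : ℝ) ^ j) ^ (P.d - 1) *
          Real.exp (-(δ / (P.L : ℝ) ^ j / 2 / P.d * ((min (x ν - c).val (c - x ν).val : ℕ) : ℝ))) := by
  have hLpos : (0 : ℝ) < (P.L : ℝ) ^ j := by have := P.hL; positivity
  have ha : 0 < δ / (P.L : ℝ) ^ j / 2 := by positivity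
  have h := sliceSum_exp_le (P := P) ha x ν c
  rw [mul_comm] at h
  exact h.trans (mul_le_mul_of_nonneg_right (sliceConst_scale_le hδ hδ1 j) (Real.exp_pos _).le)

end Slice

/-! ## §2 Two (2.10)-bumps on two scales summed over a face: the `(d−1)`-volume of the finer scale, half the decay of the coarser -/

section FacePair

variable {k : ℕ}

/-- A sum over a subset of a slice is below the indicator sum over the whole torus (nonnegative summand).
[cite: Balaban1983RegularityDecay, Sect. 5 Theorem p.594] -/
theorem sum_face_le_sum_ite {F : Finset (HiggsLattice.Site P k)} {ν : Fin P.d} {c : ZMod (P.sitesPerDir k ν)}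
    (hF : ∀ s ∈ F, s ν = c) (f : HiggsLattice.Site P k → ℝ) (hf : ∀ s, 0 ≤ f s) :
    ∑ s ∈ F, f s ≤ ∑ s : HiggsLattice.Site P k, (if s ν = c then f s else 0) := by
  classical
  rw [← Finset.sum_filter]
  refine Finset.sum_le_sum_of_subset_of_nonneg (fun s hs => ?_) (fun s _ _ => hf s)
  exact Finset.mem_filter.mpr ⟨Finset.mem_univ s, hF s hs⟩

/-- **Two bumps over a face, the FIRST the finer** (`j₁ ≤ j₂`, `0 < δ ≤ 1`, `F ⊆ {s : s_ν = c}`):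
`Σ_{s∈F} e^{−δ(L^{j₁}ε)^{−1}ε|x−s|}·e^{−δ(L^{j₂}ε)^{−1}ε|s−y|} ≤ (8d/δ)^{d−1}(L^{j₁})^{d−1}·e^{−(δ/(2d))(L^{j₁}ε)^{−1}ε·h_x}·e^{−(δ/2)(L^{j₂}ε)^{−1}ε|x−y|}`,
`h_x` = height of `x` above the slice: the `(d−1)`-volume of the finer scale, the decay of the finer bump in the height of ITS anchor, half the decay of
the coarser bump (FILE E `exp_mul_exp_le_split` + §1). [cite: Balaban1983Higgs3, (2.6) p.424, (2.10) p.426] [cite: Balaban1983RegularityDecay, Sect. 5 Theorem p.594] -/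
theorem face_conv2_le {δ : ℝ} (hδ : 0 < δ) (hδ1 : δ ≤ 1) {j₁ j₂ : ℕ} (hj : j₁ ≤ j₂)
    {F : Finset (HiggsLattice.Site P k)} {ν : Fin P.d} {c : ZMod (P.sitesPerDir k ν)} (hF : ∀ s ∈ F, s ν = c)
    (x y : HiggsLattice.Site P k) :
    ∑ s ∈ F, Real.exp (-(δ * (P.mesh j₁)⁻¹ * (P.mesh 0 * (HiggsLattice.Site.tdist x s : ℝ)))) *
        Real.exp (-(δ * (P.mesh j₂)⁻¹ * (P.mesh 0 * (HiggsLattice.Site.tdist s y : ℝ))))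
      ≤ (8 * P.d / δ) ^ (P.d - 1) * ((P.L : ℝ) ^ j₁) ^ (P.d - 1) *
          Real.exp (-(δ / (2 * P.d) * (P.mesh j₁)⁻¹ * (P.mesh 0 * ((min (x ν - c).val (c - x ν).val : ℕ) : ℝ)))) *
          Real.exp (-(δ / 2 * (P.mesh j₂)⁻¹ * (P.mesh 0 * (HiggsLattice.Site.tdist x y : ℝ)))) := by
  have hL1 : (1 : ℝ) ≤ (P.L : ℝ) := by exact_mod_cast P.hL
  simp only [rate_eq]
  set a : ℝ := δ / (P.L : ℝ) ^ j₁ with ha_def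
  set b : ℝ := δ / (P.L : ℝ) ^ j₂ with hb_def
  have ha : 0 < a := by positivity
  have hb : 0 < b := by positivity
  have hab : b ≤ a := div_le_div_of_nonneg_left hδ.le (by positivity) (pow_le_pow_right₀ hL1 hj)
  have hd0 : (0 : ℝ) < P.d := by exact_mod_cast P.hd
  -- split the decay and sum the finer bump over the face
  calc ∑ s ∈ F, Real.exp (-(a * (HiggsLattice.Site.tdist x s : ℝ))) * Real.exp (-(b * (HiggsLattice.Site.tdist s y : ℝ)))
      ≤ ∑ s ∈ F, Real.exp (-(b / 2 * (HiggsLattice.Site.tdist x y : ℝ))) * Real.exp (-(a / 2 * (HiggsLattice.Site.tdist x s : ℝ))) :=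
        Finset.sum_le_sum fun s _ => exp_mul_exp_le_split hb.le hab x s y
    _ = Real.exp (-(b / 2 * (HiggsLattice.Site.tdist x y : ℝ))) *
          ∑ s ∈ F, Real.exp (-(a / 2 * (HiggsLattice.Site.tdist x s : ℝ))) := by rw [Finset.mul_sum]
    _ ≤ Real.exp (-(b / 2 * (HiggsLattice.Site.tdist x y : ℝ))) *
          ∑ s : HiggsLattice.Site P k, (if s ν = c then Real.exp (-(a / 2 * (HiggsLattice.Site.tdist x s : ℝ))) else 0) :=
        mul_le_mul_of_nonneg_left (sum_face_le_sum_ite hF _ fun s => (Real.exp_pos _).le) (Real.exp_pos _).le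
    _ ≤ Real.exp (-(b / 2 * (HiggsLattice.Site.tdist x y : ℝ))) *
          ((8 * P.d / δ) ^ (P.d - 1) * ((P.L : ℝ) ^ j₁) ^ (P.d - 1) *
            Real.exp (-(δ / (P.L : ℝ) ^ j₁ / 2 / P.d * ((min (x ν - c).val (c - x ν).val : ℕ) : ℝ)))) := by
        refine mul_le_mul_of_nonneg_left ?_ (Real.exp_pos _).le
        have h := sliceSum_scale_le (P := P) hδ hδ1 j₁ x ν c
        simpa [ha_def] using h
    _ = _ := by
        have e1 : δ / (P.L : ℝ) ^ j₁ / 2 / P.d = δ / (2 * P.d) / (P.L : ℝ) ^ j₁ := by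
          field_simp
        have e2 : b / 2 = δ / 2 / (P.L : ℝ) ^ j₂ := by rw [hb_def]; ring
        rw [e1, e2]; ring

/-- **Two bumps over a face, the SECOND the finer** (`j₂ ≤ j₁`): the same with the height of `y` and the volume of the scale `j₂`.
[cite: Balaban1983Higgs3, (2.6) p.424, (2.10) p.426] [cite: Balaban1983RegularityDecay, Sect. 5 Theorem p.594] -/
theorem face_conv2_le' {δ : ℝ} (hδ : 0 < δ) (hδ1 : δ ≤ 1) {j₁ j₂ : ℕ} (hj : j₂ ≤ j₁)
    {F : Finset (HiggsLattice.Site P k)} {ν : Fin P.d} {c : ZMod (P.sitesPerDir k ν)} (hF : ∀ s ∈ F, s ν = c)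
    (x y : HiggsLattice.Site P k) :
    ∑ s ∈ F, Real.exp (-(δ * (P.mesh j₁)⁻¹ * (P.mesh 0 * (HiggsLattice.Site.tdist x s : ℝ)))) *
        Real.exp (-(δ * (P.mesh j₂)⁻¹ * (P.mesh 0 * (HiggsLattice.Site.tdist s y : ℝ))))
      ≤ (8 * P.d / δ) ^ (P.d - 1) * ((P.L : ℝ) ^ j₂) ^ (P.d - 1) *
          Real.exp (-(δ / (2 * P.d) * (P.mesh j₂)⁻¹ * (P.mesh 0 * ((min (y ν - c).val (c - y ν).val : ℕ) : ℝ)))) *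
          Real.exp (-(δ / 2 * (P.mesh j₁)⁻¹ * (P.mesh 0 * (HiggsLattice.Site.tdist x y : ℝ)))) := by
  have h := face_conv2_le (P := P) hδ hδ1 hj hF y x
  rw [B1Ineq234LevelZero.tdist_comm y x] at h
  refine le_trans (le_of_eq (Finset.sum_congr rfl fun s _ => ?_)) h
  rw [B1Ineq234LevelZero.tdist_comm x s, B1Ineq234LevelZero.tdist_comm s y, mul_comm]

/-- **Two bumps over a face, either order, no height factor**: `Σ_{s∈F} e_{j₁}(x,s)e_{j₂}(s,y) ≤ (8d/δ)^{d−1}(L^{min(j₁,j₂)})^{d−1}·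
e^{−(δ/2)(L^{max(j₁,j₂)}ε)^{−1}ε|x−y|}` — the face twin of `B3Op116MajorantConvolution.conv2_scales_le` (volume exponent `d − 1` instead of `d`).
[cite: Balaban1983Higgs3, (2.6) p.424, (2.10) p.426] [cite: Balaban1983RegularityDecay, Sect. 5 Theorem p.594] -/
theorem face_conv2_scales_le {δ : ℝ} (hδ : 0 < δ) (hδ1 : δ ≤ 1) (j₁ j₂ : ℕ)
    {F : Finset (HiggsLattice.Site P k)} {ν : Fin P.d} {c : ZMod (P.sitesPerDir k ν)} (hF : ∀ s ∈ F, s ν = c)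
    (x y : HiggsLattice.Site P k) :
    ∑ s ∈ F, Real.exp (-(δ * (P.mesh j₁)⁻¹ * (P.mesh 0 * (HiggsLattice.Site.tdist x s : ℝ)))) *
        Real.exp (-(δ * (P.mesh j₂)⁻¹ * (P.mesh 0 * (HiggsLattice.Site.tdist s y : ℝ))))
      ≤ (8 * P.d / δ) ^ (P.d - 1) * ((P.L : ℝ) ^ (min j₁ j₂)) ^ (P.d - 1) *
          Real.exp (-(δ / 2 * (P.mesh (max j₁ j₂))⁻¹ * (P.mesh 0 * (HiggsLattice.Site.tdist x y : ℝ)))) := by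
  have hC : 0 ≤ (8 * P.d / δ) ^ (P.d - 1) * ((P.L : ℝ) ^ (min j₁ j₂)) ^ (P.d - 1) := by positivity
  rcases le_total j₁ j₂ with h | h
  · rw [min_eq_left h, max_eq_right h]
    refine (face_conv2_le hδ hδ1 h hF x y).trans ?_
    rw [min_eq_left h] at hC
    have hH : Real.exp (-(δ / (2 * P.d) * (P.mesh j₁)⁻¹ *
        (P.mesh 0 * ((min (x ν - c).val (c - x ν).val : ℕ) : ℝ)))) ≤ 1 :=
      Real.exp_le_one_iff.mpr (by
        have : 0 ≤ δ / (2 * P.d) * (P.mesh j₁)⁻¹ * (P.mesh 0 * ((min (x ν - c).val (c - x ν).val : ℕ) : ℝ)) := by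
          have := P.mesh_pos j₁; have := P.mesh_pos 0; positivity
        linarith)
    calc _ ≤ (8 * P.d / δ) ^ (P.d - 1) * ((P.L : ℝ) ^ j₁) ^ (P.d - 1) * 1 *
          Real.exp (-(δ / 2 * (P.mesh j₂)⁻¹ * (P.mesh 0 * (HiggsLattice.Site.tdist x y : ℝ)))) :=
          mul_le_mul_of_nonneg_right (mul_le_mul_of_nonneg_left hH hC) (Real.exp_pos _).le
      _ = _ := by rw [mul_one]
  · rw [min_eq_right h, max_eq_left h]
    refine (face_conv2_le' hδ hδ1 h hF x y).trans ?_
    rw [min_eq_right h] at hC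
    have hH : Real.exp (-(δ / (2 * P.d) * (P.mesh j₂)⁻¹ *
        (P.mesh 0 * ((min (y ν - c).val (c - y ν).val : ℕ) : ℝ)))) ≤ 1 :=
      Real.exp_le_one_iff.mpr (by
        have : 0 ≤ δ / (2 * P.d) * (P.mesh j₂)⁻¹ * (P.mesh 0 * ((min (y ν - c).val (c - y ν).val : ℕ) : ℝ)) := by
          have := P.mesh_pos j₂; have := P.mesh_pos 0; positivity
        linarith)
    calc _ ≤ (8 * P.d / δ) ^ (P.d - 1) * ((P.L : ℝ) ^ j₂) ^ (P.d - 1) * 1 *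
          Real.exp (-(δ / 2 * (P.mesh j₁)⁻¹ * (P.mesh 0 * (HiggsLattice.Site.tdist x y : ℝ)))) :=
          mul_le_mul_of_nonneg_right (mul_le_mul_of_nonneg_left hH hC) (Real.exp_pos _).le
      _ = _ := by rw [mul_one]


/-- **The scale algebra of a pair over a face**: `(L^{j₁}ε)^{a₁−d}(L^{j₂}ε)^{a₂−d}(L^{min})^{d−1} = (L^{j₁}ε)^{a₁}(L^{j₂}ε)^{a₂}·((L^{max}ε)^d)^{−1}·
(L^{min}ε)^{−1}·(ε^{d−1})^{−1}` — against the two `(L^jε)^{−d}`'s the `(d−1)`-volume of the finer scale leaves the `−d` of the coarser scale, ONE inverse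
power of the finer scale (the codimension of the face) and `ε^{−(d−1)}` (the surface normalisation). [cite: Balaban1983Higgs3, (2.6) p.424, (2.10) p.426] -/
theorem face_pair_scale_algebra (j₁ j₂ : ℕ) (a₁ a₂ : ℝ) :
    P.mesh j₁ ^ (a₁ - (P.d : ℝ)) * P.mesh j₂ ^ (a₂ - (P.d : ℝ)) * ((P.L : ℝ) ^ (min j₁ j₂)) ^ (P.d - 1)
      = P.mesh j₁ ^ a₁ * P.mesh j₂ ^ a₂ * (P.mesh (max j₁ j₂) ^ P.d)⁻¹ * (P.mesh (min j₁ j₂))⁻¹ * (P.mesh 0 ^ (P.d - 1))⁻¹ := by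
  have hL0 : (0 : ℝ) < (P.L : ℝ) := by have := P.hL; positivity
  have hm0 : 0 < P.mesh 0 := P.mesh_pos 0
  have key := B3Op116MajorantConvolution.pair_scale_algebra (P := P) j₁ j₂ a₁ a₂
  have hsplit : ((P.L : ℝ) ^ (min j₁ j₂)) ^ P.d = ((P.L : ℝ) ^ (min j₁ j₂)) ^ (P.d - 1) * (P.L : ℝ) ^ (min j₁ j₂) := by
    rw [← pow_succ, Nat.sub_add_cancel P.hd]
  have hsplit0 : P.mesh 0 ^ P.d = P.mesh 0 ^ (P.d - 1) * P.mesh 0 := by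
    rw [← pow_succ, Nat.sub_add_cancel P.hd]
  have hmin : P.mesh (min j₁ j₂) = (P.L : ℝ) ^ (min j₁ j₂) * P.mesh 0 := by simp [HiggsLattice.Params.mesh]
  have hLm : (P.L : ℝ) ^ (min j₁ j₂) ≠ 0 := by positivity
  have h1 : P.mesh j₁ ^ (a₁ - (P.d : ℝ)) * P.mesh j₂ ^ (a₂ - (P.d : ℝ)) * ((P.L : ℝ) ^ (min j₁ j₂)) ^ (P.d - 1)
      = (P.mesh j₁ ^ (a₁ - (P.d : ℝ)) * P.mesh j₂ ^ (a₂ - (P.d : ℝ)) * ((P.L : ℝ) ^ (min j₁ j₂)) ^ P.d)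
          * ((P.L : ℝ) ^ (min j₁ j₂))⁻¹ := by
    rw [hsplit]; field_simp
  rw [h1, key, hmin, hsplit0]
  field_simp

end FacePair

end Literature.MathematicalPhysics.QuantumFieldTheory.Balaban1983to89.B3Op116SliceSums

end
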